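import Summits.BirchSwinnertonDyer.BirchSwinnertonDyer.Theorems.ByReductionTypeAtTwoOrdKatoHalfAtTwoIsoColemanMuFreeValueOrdKernel
import Literature.NumberTheory.EllipticCurves.Kato2004.OrdinaryKernelFunctionalOfQuotientRankProofs
import HarnessLib

/-!
# Route ByReductionTypeAtTwo, crux `OrdKatoHalfAtTwoIso` (stmt-BirchSwinnertonDyer-19573), line `steinberg-fibre-at-two`,
# F1 slot (child stmt-BirchSwinnertonDyer-24097): the value texts are CHOICE-FREE — the `∃ col` texts V∓ (p727025) and the
# registered `∀ col` texts V♭∓ are EQUIVALENT modulo two print facts ((12.2.3) and «ordinary quotient torsion-free of rank one»),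
# and the cite stub `stub_ordKernelFunctional` is a theorem modulo the same two facts

Seat `cruxlead-stmt-BirchSwinnertonDyer-19573-w3` g8 (prover WIDTH under the LEAD `cruxlead-19573`; HOME `run/shared/lean/pub/bsd-2adic/`;
`--supports` stmt-BirchSwinnertonDyer-24097).  THEOREMS ONLY (no definition, no named fact, no `sorry`, no instance).  HONEST FRAMING
(cell bsd-2adic): BSD is not proved by any of this; F1μι⁻, P⁺, the children and the crux are NOT proved here; V∓ / V♭∓ below are
displayed HYPOTHESES (memo tier), and the two Literature inputs `localIwasawaH1_tateRep_moduleFinite` ((12.2.3), conv-1 GEN 27) and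
`localIwasawaH1_ordinaryQuotient_isTorsionFree_rank_eq_one` (this seat, p740652; Perrin-Riou's structure of `𝐇¹_Iw(T/F⁺T)` + Kato
p. 277) are NAMED FACTS — every theorem here is CONDITIONAL on them and says so in its signature.

WHY.  The registered v23/v24 memo stub of the `Δ < 0` cell is the `∀`-form V♭⁻ («EVERY normalised functional `col : 𝐇¹_{loc,Γ}(T₂W) → Λ`
with kernel EXACTLY `range(𝐇¹_{loc,Γ}(F⁺T))` takes a value `∉ (2)` at `loc₂ g` of some GENUINE class `g`»), consumed together with the
cite stub `stub_ordKernelFunctional : exists_ordinaryKernelFunctional` (p727215) to produce the `∃`-form V⁻ of p727025 («SOME `col` with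
`ker col ≤ range(…)` and a genuine `g` with `col (loc₂ g) ∉ (2)`»), from which F1μι⁻ follows over the Tate-duality fact alone
(`zetaColemanMuIotaNegDiscAtTwo_of_tateDuality_of_muFreeValue`).  The sibling `…ColemanMuFreeValueOrdKernel.lean` records: «any two
normalised ordinary-kernel functionals differ by a factor `λ ∈ Λ ∖ (2)` once a finite-cokernel one exists (reflexive hull; NOT
asserted, not used), so V♭ is the choice-free phrasing of V».  This file ASSERTS AND USES it, as a theorem of the Literature
companion `Kato2004/OrdinaryKernelFunctionalOfQuotientRankProofs.lean` (this seat): over `Λ = ℤ_p⟦X⟧`, for `M` finitely generated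
with `M ⧸ N` torsion-free of rank one, (i) a functional with `ker ≤ N` KILLS `N` (rank–nullity), (ii) a saturated exact-kernel
functional exists and every functional vanishing on `N` is a `Λ`-multiple of it, (iii) hence for any two functionals with
`ker ≤ N` and a value outside `(p)` each, «value at `m` lies outside `(p)`» agrees.  CONSEQUENCE FOR THE SKELETON (the LEAD's call,
not executed here): registering the `∃`-form V⁻ (p727025's text) instead of V♭⁻ makes `stub_ordKernelFunctional` unnecessary for
F1μι⁻ (one cite stub fewer), with NO loss of extent — V♭⁻ is recovered from V⁻ by `muFreeValue_negDisc_of_exists_of_ordinaryQuotientRank`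
modulo the two print facts; conversely `exists_ordinaryKernelFunctional` itself is
`Kato2004.exists_ordinaryKernelFunctional_of_moduleFinite_of_ordinaryQuotientRank` applied to the same two facts.

* §1 (`Δ < 0`, genuine class) `muFreeValue_negDisc_of_exists_of_ordinaryQuotientRank` (V⁻ ⇒ V♭⁻), `exists_of_muFreeValue_negDisc_of_ordinaryQuotientRank`
  (V♭⁻ ⇒ V⁻), `muFreeValue_negDisc_iff_exists_of_ordinaryQuotientRank` (V♭⁻ ⟺ V⁻) — all modulo the two facts.
* §2 (`0 < Δ`, one global class) the twins `muFreeValue_posDisc_of_exists_of_ordinaryQuotientRank`, `exists_of_muFreeValue_posDisc_of_ordinaryQuotientRank`,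
  `muFreeValue_posDisc_iff_exists_of_ordinaryQuotientRank` (display: V♭⁺/P⁺ left the registered cone at v24).
* §3 F1μι⁻ = `ZetaColemanMuIotaNegDiscAtTwo` BY NAME from {Tate duality p723619, (12.2.3), structure fact, V♭⁻}
  (`zetaColemanMuIotaNegDiscAtTwo_of_tateDuality_of_facts_of_muFreeValue`); the cite stub's statement itself is the Literature theorem
  `Kato2004.exists_ordinaryKernelFunctional_of_moduleFinite_of_ordinaryQuotientRank` (cite it BY NAME in the skeleton if so registered).

References: [Kato2004Asterisque] Prop 17.11 with proof (p. 277), 13.14 (p. 234), Thm 12.6 (p. 222), Thm 16.6 (2) (p. 271), §17.13;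
[PerrinRiou2000JAMS] §1.1 (p. 537); [BourbakiAC5to7] VII §4 nos. 1–2; tree p727025, p727215, p727801, p740652 and the companion proofs file.
-/

set_option autoImplicit false
set_option linter.dupNamespace false

noncomputable section

open scoped Classical MatrixGroups ModularForm NumberField
open CongruenceSubgroup WeierstrassCurve Field IsDedekindDomain NumberField
open Literature.NumberTheory.GaloisRepresentations
open Literature.NumberTheory.GaloisCohomology
open Literature.NumberTheory.EllipticCurves Literature.NumberTheory.EllipticCurves.ModularForms
  Literature.NumberTheory.EllipticCurves.GreenbergSelmer
open Literature.NumberTheory.EllipticCurves.Kato2004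
  Literature.NumberTheory.EllipticCurves.Kato2004.EulerSystemValues
open Literature.NumberTheory.EllipticCurves.IwasawaDual
open Literature.NumberTheory.EllipticCurves.Rank1Residual
open Literature.NumberTheory.EllipticCurves.Greenberg1999
open Summit.BirchSwinnertonDyer.Rank1Residual Summit.BirchSwinnertonDyer.Rank1Residual.X5
open Summit.BirchSwinnertonDyer.BirchSwinnertonDyer.Theses.ByReductionTypeAtTwo

namespace Summit.BirchSwinnertonDyer.BirchSwinnertonDyer.Theorems.SteinbergFibreAtTwo

/-! ## §1 `Δ < 0` (genuine class): V⁻ ⟺ V♭⁻ modulo (12.2.3) and the structure fact -/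

/-- **V⁻ ⟹ V♭⁻ modulo the two facts (`Δ < 0`, genuine class): the `∃ col` value text implies the `∀ col` value text.**  Given, for every
cell datum and all carriers, SOME `col₀ : 𝐇¹_{loc,Γ}(T₂W) → Λ` with `ker col₀ ≤ range(𝐇¹_{loc,Γ}(F⁺T))` and a genuine class `g` with
`col₀ (loc₂ g) ∉ (2)` (V⁻, p727025's text), EVERY normalised exact-kernel `col` satisfies `col (loc₂ g) ∉ (2)` for the SAME `g`:
`Kato2004.ordinaryKernelFunctional_notMem_iff_of_ker_le_of_moduleFinite_of_ordinaryQuotientRank` (both functionals have kernel inside the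
ordinary classes and a value outside `(2)`; the ordinary quotient is f.g. torsion-free of rank one by the two facts).  CONDITIONAL; nothing closed.
[cite: Kato2004Asterisque, Prop. 17.11 with proof (p. 277), 13.14 (p. 234)] [cite: PerrinRiou2000JAMS, §1.1 (p. 537)] [cite: BourbakiAC5to7, Ch. VII §4 nos. 1–2] -/
theorem muFreeValue_negDisc_of_exists_of_ordinaryQuotientRank
    (hfin : localIwasawaH1_tateRep_moduleFinite) (hQ : localIwasawaH1_ordinaryQuotient_isTorsionFree_rank_eq_one)
    (hV : ∀ (W : WeierstrassCurve ℚ) [W.IsElliptic] [W.IsGloballyMinimal]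
      [ContinuousSMul ℤ_[2] (W.tateModule 2)] [Module.Free ℤ_[2] (W.tateModule 2)] [Module.Finite ℤ_[2] (W.tateModule 2)]
      {N : ℕ} [NeZero N] (f : CuspForm (Gamma0 N) 2)
      (κ : ZpExtension ℚ 2) (γ : absoluteGaloisGroup ℚ) (hκ : κ.IsCyclotomic) (hγ : κ.IsTopGenerator γ),
      W.Δ < 0 → IsOrdinaryAt W 2 → W.HasSurjectiveModNGaloisRep 2 → IsCyclotomicVariable 2 γ → IsNewformOf W f →
      ∀ (v₂ : HeightOneSpectrum (𝓞 ℚ)) (_ : ((2 : ℕ) : 𝓞 ℚ) ∈ v₂.asIdeal)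
        (γᵥ : absoluteGaloisGroup (v₂.adicCompletion ℚ))
        (hsurj : Function.Surjective
          (κ.toContinuousMonoidHom.comp (resGalOfEmb (closureEmb (K := ℚ) (v₂.adicCompletion ℚ)))))
        (hγᵥ : κ.IsTopGenerator (resGalOfEmb (closureEmb (K := ℚ) (v₂.adicCompletion ℚ)) γᵥ))
        (I : IwasawaH1Data W 2 κ γ) (J : LocalIwasawaH1Data κ v₂ ((tateRep W 2).toLocal v₂) γᵥ)
        (J' : LocalIwasawaH1Data κ v₂ (tateLocalOrdinaryRep W 2 v₂) γᵥ),
      ∃ col : J.H →ₗ[IwasawaAlgebra 2] IwasawaAlgebra 2,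
        (∀ x : J.H, col x = 0 → x ∈ LinearMap.range (J'.ordinaryInclusion J)) ∧
        ∃ g : I.H, IsEulerSystemClassTwo W hκ I g ∧ col (I.loc J hsurj hγ hγᵥ g) ∉ IwasawaAlgebra.augIdealP 2) :
    ∀ (W : WeierstrassCurve ℚ) [W.IsElliptic] [W.IsGloballyMinimal]
      [ContinuousSMul ℤ_[2] (W.tateModule 2)] [Module.Free ℤ_[2] (W.tateModule 2)] [Module.Finite ℤ_[2] (W.tateModule 2)]
      {N : ℕ} [NeZero N] (f : CuspForm (Gamma0 N) 2)
      (κ : ZpExtension ℚ 2) (γ : absoluteGaloisGroup ℚ) (hκ : κ.IsCyclotomic) (hγ : κ.IsTopGenerator γ),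
      W.Δ < 0 → IsOrdinaryAt W 2 → W.HasSurjectiveModNGaloisRep 2 → IsCyclotomicVariable 2 γ → IsNewformOf W f →
      ∀ (v₂ : HeightOneSpectrum (𝓞 ℚ)) (_ : ((2 : ℕ) : 𝓞 ℚ) ∈ v₂.asIdeal)
        (γᵥ : absoluteGaloisGroup (v₂.adicCompletion ℚ))
        (hsurj : Function.Surjective
          (κ.toContinuousMonoidHom.comp (resGalOfEmb (closureEmb (K := ℚ) (v₂.adicCompletion ℚ)))))
        (hγᵥ : κ.IsTopGenerator (resGalOfEmb (closureEmb (K := ℚ) (v₂.adicCompletion ℚ)) γᵥ))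
        (I : IwasawaH1Data W 2 κ γ) (J : LocalIwasawaH1Data κ v₂ ((tateRep W 2).toLocal v₂) γᵥ)
        (J' : LocalIwasawaH1Data κ v₂ (tateLocalOrdinaryRep W 2 v₂) γᵥ)
        (col : J.H →ₗ[IwasawaAlgebra 2] IwasawaAlgebra 2),
        (∀ x : J.H, col x = 0 ↔ x ∈ LinearMap.range (J'.ordinaryInclusion J)) →
        (∃ x : J.H, col x ∉ IwasawaAlgebra.augIdealP 2) →
        ∃ g : I.H, IsEulerSystemClassTwo W hκ I g ∧ col (I.loc J hsurj hγ hγᵥ g) ∉ IwasawaAlgebra.augIdealP 2 := by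
  intro W _ _ _ _ _ N _ f κ γ hκ hγ hΔ hord h2 hγ' hf v₂ hv₂ γᵥ hsurj hγᵥ I J J' col hker hnorm
  obtain ⟨col₀, hker₀, g, hg, hval₀⟩ := hV W f κ γ hκ hγ hΔ hord h2 hγ' hf v₂ hv₂ γᵥ hsurj hγᵥ I J J'
  refine ⟨g, hg, ?_⟩
  exact (ordinaryKernelFunctional_notMem_iff_of_ker_le_of_moduleFinite_of_ordinaryQuotientRank hfin hQ W hκ hv₂ hord hγᵥ
    J J' col col₀ (fun x hx => (hker x).mp hx) hnorm hker₀ ⟨_, hval₀⟩ (I.loc J hsurj hγ hγᵥ g)).mpr hval₀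

/-- **V♭⁻ ⟹ V⁻ modulo the two facts (`Δ < 0`)**: the converse — instantiate the `∀ col` text at the normalised exact-kernel functional
that EXISTS by `Kato2004.exists_ordinaryKernelFunctional_of_moduleFinite_of_ordinaryQuotientRank` (the cite stub's statement, now a
theorem modulo (12.2.3) + the structure fact); = the sibling `muFreeValue_negDisc_of_ordKernel` fed with that theorem.  CONDITIONAL.
[cite: Kato2004Asterisque, Prop. 17.11 with proof (p. 277)] [cite: PerrinRiou2000JAMS, §1.1 (p. 537)] [cite: BourbakiAC5to7, Ch. VII §4 nos. 1–2] -/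
theorem exists_of_muFreeValue_negDisc_of_ordinaryQuotientRank
    (hfin : localIwasawaH1_tateRep_moduleFinite) (hQ : localIwasawaH1_ordinaryQuotient_isTorsionFree_rank_eq_one)
    (hVflat : ∀ (W : WeierstrassCurve ℚ) [W.IsElliptic] [W.IsGloballyMinimal]
      [ContinuousSMul ℤ_[2] (W.tateModule 2)] [Module.Free ℤ_[2] (W.tateModule 2)] [Module.Finite ℤ_[2] (W.tateModule 2)]
      {N : ℕ} [NeZero N] (f : CuspForm (Gamma0 N) 2)
      (κ : ZpExtension ℚ 2) (γ : absoluteGaloisGroup ℚ) (hκ : κ.IsCyclotomic) (hγ : κ.IsTopGenerator γ),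
      W.Δ < 0 → IsOrdinaryAt W 2 → W.HasSurjectiveModNGaloisRep 2 → IsCyclotomicVariable 2 γ → IsNewformOf W f →
      ∀ (v₂ : HeightOneSpectrum (𝓞 ℚ)) (_ : ((2 : ℕ) : 𝓞 ℚ) ∈ v₂.asIdeal)
        (γᵥ : absoluteGaloisGroup (v₂.adicCompletion ℚ))
        (hsurj : Function.Surjective
          (κ.toContinuousMonoidHom.comp (resGalOfEmb (closureEmb (K := ℚ) (v₂.adicCompletion ℚ)))))
        (hγᵥ : κ.IsTopGenerator (resGalOfEmb (closureEmb (K := ℚ) (v₂.adicCompletion ℚ)) γᵥ))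
        (I : IwasawaH1Data W 2 κ γ) (J : LocalIwasawaH1Data κ v₂ ((tateRep W 2).toLocal v₂) γᵥ)
        (J' : LocalIwasawaH1Data κ v₂ (tateLocalOrdinaryRep W 2 v₂) γᵥ)
        (col : J.H →ₗ[IwasawaAlgebra 2] IwasawaAlgebra 2),
        (∀ x : J.H, col x = 0 ↔ x ∈ LinearMap.range (J'.ordinaryInclusion J)) →
        (∃ x : J.H, col x ∉ IwasawaAlgebra.augIdealP 2) →
        ∃ g : I.H, IsEulerSystemClassTwo W hκ I g ∧ col (I.loc J hsurj hγ hγᵥ g) ∉ IwasawaAlgebra.augIdealP 2) :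
    ∀ (W : WeierstrassCurve ℚ) [W.IsElliptic] [W.IsGloballyMinimal]
      [ContinuousSMul ℤ_[2] (W.tateModule 2)] [Module.Free ℤ_[2] (W.tateModule 2)] [Module.Finite ℤ_[2] (W.tateModule 2)]
      {N : ℕ} [NeZero N] (f : CuspForm (Gamma0 N) 2)
      (κ : ZpExtension ℚ 2) (γ : absoluteGaloisGroup ℚ) (hκ : κ.IsCyclotomic) (hγ : κ.IsTopGenerator γ),
      W.Δ < 0 → IsOrdinaryAt W 2 → W.HasSurjectiveModNGaloisRep 2 → IsCyclotomicVariable 2 γ → IsNewformOf W f →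
      ∀ (v₂ : HeightOneSpectrum (𝓞 ℚ)) (_ : ((2 : ℕ) : 𝓞 ℚ) ∈ v₂.asIdeal)
        (γᵥ : absoluteGaloisGroup (v₂.adicCompletion ℚ))
        (hsurj : Function.Surjective
          (κ.toContinuousMonoidHom.comp (resGalOfEmb (closureEmb (K := ℚ) (v₂.adicCompletion ℚ)))))
        (hγᵥ : κ.IsTopGenerator (resGalOfEmb (closureEmb (K := ℚ) (v₂.adicCompletion ℚ)) γᵥ))
        (I : IwasawaH1Data W 2 κ γ) (J : LocalIwasawaH1Data κ v₂ ((tateRep W 2).toLocal v₂) γᵥ)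
        (J' : LocalIwasawaH1Data κ v₂ (tateLocalOrdinaryRep W 2 v₂) γᵥ),
      ∃ col : J.H →ₗ[IwasawaAlgebra 2] IwasawaAlgebra 2,
        (∀ x : J.H, col x = 0 → x ∈ LinearMap.range (J'.ordinaryInclusion J)) ∧
        ∃ g : I.H, IsEulerSystemClassTwo W hκ I g ∧ col (I.loc J hsurj hγ hγᵥ g) ∉ IwasawaAlgebra.augIdealP 2 :=
  muFreeValue_negDisc_of_ordKernel (exists_ordinaryKernelFunctional_of_moduleFinite_of_ordinaryQuotientRank hfin hQ) hVflat

/-- **V♭⁻ ⟺ V⁻ modulo (12.2.3) and the structure fact (`Δ < 0`)** — the registered `∀ col` value text and p727025's `∃ col` value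
text are EXTENT-EQUAL over the two print facts: registering either one is the same memo content.  CONDITIONAL on the two facts.
[cite: Kato2004Asterisque, Prop. 17.11 with proof (p. 277), 13.14 (p. 234)] [cite: BourbakiAC5to7, Ch. VII §4 nos. 1–2] -/
theorem muFreeValue_negDisc_iff_exists_of_ordinaryQuotientRank
    (hfin : localIwasawaH1_tateRep_moduleFinite) (hQ : localIwasawaH1_ordinaryQuotient_isTorsionFree_rank_eq_one) :
    (∀ (W : WeierstrassCurve ℚ) [W.IsElliptic] [W.IsGloballyMinimal]
      [ContinuousSMul ℤ_[2] (W.tateModule 2)] [Module.Free ℤ_[2] (W.tateModule 2)] [Module.Finite ℤ_[2] (W.tateModule 2)]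
      {N : ℕ} [NeZero N] (f : CuspForm (Gamma0 N) 2)
      (κ : ZpExtension ℚ 2) (γ : absoluteGaloisGroup ℚ) (hκ : κ.IsCyclotomic) (hγ : κ.IsTopGenerator γ),
      W.Δ < 0 → IsOrdinaryAt W 2 → W.HasSurjectiveModNGaloisRep 2 → IsCyclotomicVariable 2 γ → IsNewformOf W f →
      ∀ (v₂ : HeightOneSpectrum (𝓞 ℚ)) (_ : ((2 : ℕ) : 𝓞 ℚ) ∈ v₂.asIdeal)
        (γᵥ : absoluteGaloisGroup (v₂.adicCompletion ℚ))
        (hsurj : Function.Surjective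
          (κ.toContinuousMonoidHom.comp (resGalOfEmb (closureEmb (K := ℚ) (v₂.adicCompletion ℚ)))))
        (hγᵥ : κ.IsTopGenerator (resGalOfEmb (closureEmb (K := ℚ) (v₂.adicCompletion ℚ)) γᵥ))
        (I : IwasawaH1Data W 2 κ γ) (J : LocalIwasawaH1Data κ v₂ ((tateRep W 2).toLocal v₂) γᵥ)
        (J' : LocalIwasawaH1Data κ v₂ (tateLocalOrdinaryRep W 2 v₂) γᵥ)
        (col : J.H →ₗ[IwasawaAlgebra 2] IwasawaAlgebra 2),
        (∀ x : J.H, col x = 0 ↔ x ∈ LinearMap.range (J'.ordinaryInclusion J)) →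
        (∃ x : J.H, col x ∉ IwasawaAlgebra.augIdealP 2) →
        ∃ g : I.H, IsEulerSystemClassTwo W hκ I g ∧ col (I.loc J hsurj hγ hγᵥ g) ∉ IwasawaAlgebra.augIdealP 2) ↔
    (∀ (W : WeierstrassCurve ℚ) [W.IsElliptic] [W.IsGloballyMinimal]
      [ContinuousSMul ℤ_[2] (W.tateModule 2)] [Module.Free ℤ_[2] (W.tateModule 2)] [Module.Finite ℤ_[2] (W.tateModule 2)]
      {N : ℕ} [NeZero N] (f : CuspForm (Gamma0 N) 2)
      (κ : ZpExtension ℚ 2) (γ : absoluteGaloisGroup ℚ) (hκ : κ.IsCyclotomic) (hγ : κ.IsTopGenerator γ),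
      W.Δ < 0 → IsOrdinaryAt W 2 → W.HasSurjectiveModNGaloisRep 2 → IsCyclotomicVariable 2 γ → IsNewformOf W f →
      ∀ (v₂ : HeightOneSpectrum (𝓞 ℚ)) (_ : ((2 : ℕ) : 𝓞 ℚ) ∈ v₂.asIdeal)
        (γᵥ : absoluteGaloisGroup (v₂.adicCompletion ℚ))
        (hsurj : Function.Surjective
          (κ.toContinuousMonoidHom.comp (resGalOfEmb (closureEmb (K := ℚ) (v₂.adicCompletion ℚ)))))
        (hγᵥ : κ.IsTopGenerator (resGalOfEmb (closureEmb (K := ℚ) (v₂.adicCompletion ℚ)) γᵥ))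
        (I : IwasawaH1Data W 2 κ γ) (J : LocalIwasawaH1Data κ v₂ ((tateRep W 2).toLocal v₂) γᵥ)
        (J' : LocalIwasawaH1Data κ v₂ (tateLocalOrdinaryRep W 2 v₂) γᵥ),
      ∃ col : J.H →ₗ[IwasawaAlgebra 2] IwasawaAlgebra 2,
        (∀ x : J.H, col x = 0 → x ∈ LinearMap.range (J'.ordinaryInclusion J)) ∧
        ∃ g : I.H, IsEulerSystemClassTwo W hκ I g ∧ col (I.loc J hsurj hγ hγᵥ g) ∉ IwasawaAlgebra.augIdealP 2) :=
  ⟨exists_of_muFreeValue_negDisc_of_ordinaryQuotientRank hfin hQ,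
    muFreeValue_negDisc_of_exists_of_ordinaryQuotientRank hfin hQ⟩

/-! ## §2 `0 < Δ` (one global class): V⁺ ⟺ V♭⁺ modulo the same two facts (display; V♭⁺/P⁺ left the registered cone at v24) -/

/-- **V⁺ ⟹ V♭⁺ modulo the two facts (`0 < Δ`, one global class)**: the `∃ col` text with some `y ∈ 𝐇¹_Γ`, `col (loc₂ y) ∉ (2)`,
implies the `∀ col` text for the SAME `y` (choice-freeness, as in §1).  CONDITIONAL; nothing closed.
[cite: Kato2004Asterisque, Prop. 17.11 with proof (p. 277), 13.14 (p. 234)] [cite: BourbakiAC5to7, Ch. VII §4 nos. 1–2] -/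
theorem muFreeValue_posDisc_of_exists_of_ordinaryQuotientRank
    (hfin : localIwasawaH1_tateRep_moduleFinite) (hQ : localIwasawaH1_ordinaryQuotient_isTorsionFree_rank_eq_one)
    (hV : ∀ (W : WeierstrassCurve ℚ) [W.IsElliptic] [W.IsGloballyMinimal]
      [ContinuousSMul ℤ_[2] (W.tateModule 2)] [Module.Free ℤ_[2] (W.tateModule 2)] [Module.Finite ℤ_[2] (W.tateModule 2)]
      {N : ℕ} [NeZero N] (f : CuspForm (Gamma0 N) 2)
      (κ : ZpExtension ℚ 2) (γ : absoluteGaloisGroup ℚ) (hκ : κ.IsCyclotomic) (hγ : κ.IsTopGenerator γ),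
      0 < W.Δ → IsOrdinaryAt W 2 → W.HasSurjectiveModNGaloisRep 2 → IsCyclotomicVariable 2 γ → IsNewformOf W f →
      ∀ (v₂ : HeightOneSpectrum (𝓞 ℚ)) (_ : ((2 : ℕ) : 𝓞 ℚ) ∈ v₂.asIdeal)
        (γᵥ : absoluteGaloisGroup (v₂.adicCompletion ℚ))
        (hsurj : Function.Surjective
          (κ.toContinuousMonoidHom.comp (resGalOfEmb (closureEmb (K := ℚ) (v₂.adicCompletion ℚ)))))
        (hγᵥ : κ.IsTopGenerator (resGalOfEmb (closureEmb (K := ℚ) (v₂.adicCompletion ℚ)) γᵥ))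
        (I : IwasawaH1Data W 2 κ γ) (J : LocalIwasawaH1Data κ v₂ ((tateRep W 2).toLocal v₂) γᵥ)
        (J' : LocalIwasawaH1Data κ v₂ (tateLocalOrdinaryRep W 2 v₂) γᵥ),
      ∃ col : J.H →ₗ[IwasawaAlgebra 2] IwasawaAlgebra 2,
        (∀ x : J.H, col x = 0 → x ∈ LinearMap.range (J'.ordinaryInclusion J)) ∧
        ∃ y : I.H, col (I.loc J hsurj hγ hγᵥ y) ∉ IwasawaAlgebra.augIdealP 2) :
    ∀ (W : WeierstrassCurve ℚ) [W.IsElliptic] [W.IsGloballyMinimal]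
      [ContinuousSMul ℤ_[2] (W.tateModule 2)] [Module.Free ℤ_[2] (W.tateModule 2)] [Module.Finite ℤ_[2] (W.tateModule 2)]
      {N : ℕ} [NeZero N] (f : CuspForm (Gamma0 N) 2)
      (κ : ZpExtension ℚ 2) (γ : absoluteGaloisGroup ℚ) (hκ : κ.IsCyclotomic) (hγ : κ.IsTopGenerator γ),
      0 < W.Δ → IsOrdinaryAt W 2 → W.HasSurjectiveModNGaloisRep 2 → IsCyclotomicVariable 2 γ → IsNewformOf W f →
      ∀ (v₂ : HeightOneSpectrum (𝓞 ℚ)) (_ : ((2 : ℕ) : 𝓞 ℚ) ∈ v₂.asIdeal)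
        (γᵥ : absoluteGaloisGroup (v₂.adicCompletion ℚ))
        (hsurj : Function.Surjective
          (κ.toContinuousMonoidHom.comp (resGalOfEmb (closureEmb (K := ℚ) (v₂.adicCompletion ℚ)))))
        (hγᵥ : κ.IsTopGenerator (resGalOfEmb (closureEmb (K := ℚ) (v₂.adicCompletion ℚ)) γᵥ))
        (I : IwasawaH1Data W 2 κ γ) (J : LocalIwasawaH1Data κ v₂ ((tateRep W 2).toLocal v₂) γᵥ)
        (J' : LocalIwasawaH1Data κ v₂ (tateLocalOrdinaryRep W 2 v₂) γᵥ)
        (col : J.H →ₗ[IwasawaAlgebra 2] IwasawaAlgebra 2),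
        (∀ x : J.H, col x = 0 ↔ x ∈ LinearMap.range (J'.ordinaryInclusion J)) →
        (∃ x : J.H, col x ∉ IwasawaAlgebra.augIdealP 2) →
        ∃ y : I.H, col (I.loc J hsurj hγ hγᵥ y) ∉ IwasawaAlgebra.augIdealP 2 := by
  intro W _ _ _ _ _ N _ f κ γ hκ hγ hΔ hord h2 hγ' hf v₂ hv₂ γᵥ hsurj hγᵥ I J J' col hker hnorm
  obtain ⟨col₀, hker₀, y, hval₀⟩ := hV W f κ γ hκ hγ hΔ hord h2 hγ' hf v₂ hv₂ γᵥ hsurj hγᵥ I J J'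
  refine ⟨y, ?_⟩
  exact (ordinaryKernelFunctional_notMem_iff_of_ker_le_of_moduleFinite_of_ordinaryQuotientRank hfin hQ W hκ hv₂ hord hγᵥ
    J J' col col₀ (fun x hx => (hker x).mp hx) hnorm hker₀ ⟨_, hval₀⟩ (I.loc J hsurj hγ hγᵥ y)).mpr hval₀

/-- **V♭⁺ ⟹ V⁺ modulo the two facts (`0 < Δ`)**: instantiate at the functional of
`Kato2004.exists_ordinaryKernelFunctional_of_moduleFinite_of_ordinaryQuotientRank` (= the sibling `muFreeValue_posDisc_of_ordKernel` fed
with that theorem).  CONDITIONAL. [cite: Kato2004Asterisque, Prop. 17.11 with proof (p. 277)] [cite: BourbakiAC5to7, Ch. VII §4 nos. 1–2] -/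
theorem exists_of_muFreeValue_posDisc_of_ordinaryQuotientRank
    (hfin : localIwasawaH1_tateRep_moduleFinite) (hQ : localIwasawaH1_ordinaryQuotient_isTorsionFree_rank_eq_one)
    (hVflat : ∀ (W : WeierstrassCurve ℚ) [W.IsElliptic] [W.IsGloballyMinimal]
      [ContinuousSMul ℤ_[2] (W.tateModule 2)] [Module.Free ℤ_[2] (W.tateModule 2)] [Module.Finite ℤ_[2] (W.tateModule 2)]
      {N : ℕ} [NeZero N] (f : CuspForm (Gamma0 N) 2)
      (κ : ZpExtension ℚ 2) (γ : absoluteGaloisGroup ℚ) (hκ : κ.IsCyclotomic) (hγ : κ.IsTopGenerator γ),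
      0 < W.Δ → IsOrdinaryAt W 2 → W.HasSurjectiveModNGaloisRep 2 → IsCyclotomicVariable 2 γ → IsNewformOf W f →
      ∀ (v₂ : HeightOneSpectrum (𝓞 ℚ)) (_ : ((2 : ℕ) : 𝓞 ℚ) ∈ v₂.asIdeal)
        (γᵥ : absoluteGaloisGroup (v₂.adicCompletion ℚ))
        (hsurj : Function.Surjective
          (κ.toContinuousMonoidHom.comp (resGalOfEmb (closureEmb (K := ℚ) (v₂.adicCompletion ℚ)))))
        (hγᵥ : κ.IsTopGenerator (resGalOfEmb (closureEmb (K := ℚ) (v₂.adicCompletion ℚ)) γᵥ))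
        (I : IwasawaH1Data W 2 κ γ) (J : LocalIwasawaH1Data κ v₂ ((tateRep W 2).toLocal v₂) γᵥ)
        (J' : LocalIwasawaH1Data κ v₂ (tateLocalOrdinaryRep W 2 v₂) γᵥ)
        (col : J.H →ₗ[IwasawaAlgebra 2] IwasawaAlgebra 2),
        (∀ x : J.H, col x = 0 ↔ x ∈ LinearMap.range (J'.ordinaryInclusion J)) →
        (∃ x : J.H, col x ∉ IwasawaAlgebra.augIdealP 2) →
        ∃ y : I.H, col (I.loc J hsurj hγ hγᵥ y) ∉ IwasawaAlgebra.augIdealP 2) :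
    ∀ (W : WeierstrassCurve ℚ) [W.IsElliptic] [W.IsGloballyMinimal]
      [ContinuousSMul ℤ_[2] (W.tateModule 2)] [Module.Free ℤ_[2] (W.tateModule 2)] [Module.Finite ℤ_[2] (W.tateModule 2)]
      {N : ℕ} [NeZero N] (f : CuspForm (Gamma0 N) 2)
      (κ : ZpExtension ℚ 2) (γ : absoluteGaloisGroup ℚ) (hκ : κ.IsCyclotomic) (hγ : κ.IsTopGenerator γ),
      0 < W.Δ → IsOrdinaryAt W 2 → W.HasSurjectiveModNGaloisRep 2 → IsCyclotomicVariable 2 γ → IsNewformOf W f →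
      ∀ (v₂ : HeightOneSpectrum (𝓞 ℚ)) (_ : ((2 : ℕ) : 𝓞 ℚ) ∈ v₂.asIdeal)
        (γᵥ : absoluteGaloisGroup (v₂.adicCompletion ℚ))
        (hsurj : Function.Surjective
          (κ.toContinuousMonoidHom.comp (resGalOfEmb (closureEmb (K := ℚ) (v₂.adicCompletion ℚ)))))
        (hγᵥ : κ.IsTopGenerator (resGalOfEmb (closureEmb (K := ℚ) (v₂.adicCompletion ℚ)) γᵥ))
        (I : IwasawaH1Data W 2 κ γ) (J : LocalIwasawaH1Data κ v₂ ((tateRep W 2).toLocal v₂) γᵥ)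
        (J' : LocalIwasawaH1Data κ v₂ (tateLocalOrdinaryRep W 2 v₂) γᵥ),
      ∃ col : J.H →ₗ[IwasawaAlgebra 2] IwasawaAlgebra 2,
        (∀ x : J.H, col x = 0 → x ∈ LinearMap.range (J'.ordinaryInclusion J)) ∧
        ∃ y : I.H, col (I.loc J hsurj hγ hγᵥ y) ∉ IwasawaAlgebra.augIdealP 2 :=
  muFreeValue_posDisc_of_ordKernel (exists_ordinaryKernelFunctional_of_moduleFinite_of_ordinaryQuotientRank hfin hQ) hVflat

/-! ## §3 BY NAME for the skeleton: F1μι⁻ from the two facts (the cite stub's statement = `Kato2004.exists_ordinaryKernelFunctional_of_moduleFinite_of_ordinaryQuotientRank`) -/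

/-- **F1μι⁻ = `ZetaColemanMuIotaNegDiscAtTwo` (conjunct 1 of child 24097) BY NAME from {Tate duality along the tower (p723619), (12.2.3),
the structure fact, V♭⁻}** — the sibling `zetaColemanMuIotaNegDiscAtTwo_of_tateDuality_of_ordKernel_of_muFreeValue` with its `hOK` input
DISCHARGED by the two print facts.  CONDITIONAL; nothing closed. [cite: MilneADT2006, Ch. I Cor. 2.3 and Thm. 4.10] [cite: PerrinRiou2000JAMS, §1.1 (p. 537)]
[cite: Kato2004Asterisque, §12.2 (12.2.3) (p. 220), Thm 12.6 (p. 222), Thm 16.6 (2) (p. 271), Prop. 17.11 (p. 277), §17.13 (pp. 279–280)] -/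
theorem zetaColemanMuIotaNegDiscAtTwo_of_tateDuality_of_facts_of_muFreeValue
    (hPT : exists_lambdaAdicLocalTatePairing_selmer_orthogonal)
    (hfin : localIwasawaH1_tateRep_moduleFinite) (hQ : localIwasawaH1_ordinaryQuotient_isTorsionFree_rank_eq_one)
    (hVflat : ∀ (W : WeierstrassCurve ℚ) [W.IsElliptic] [W.IsGloballyMinimal]
      [ContinuousSMul ℤ_[2] (W.tateModule 2)] [Module.Free ℤ_[2] (W.tateModule 2)] [Module.Finite ℤ_[2] (W.tateModule 2)]
      {N : ℕ} [NeZero N] (f : CuspForm (Gamma0 N) 2)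
      (κ : ZpExtension ℚ 2) (γ : absoluteGaloisGroup ℚ) (hκ : κ.IsCyclotomic) (hγ : κ.IsTopGenerator γ),
      W.Δ < 0 → IsOrdinaryAt W 2 → W.HasSurjectiveModNGaloisRep 2 → IsCyclotomicVariable 2 γ → IsNewformOf W f →
      ∀ (v₂ : HeightOneSpectrum (𝓞 ℚ)) (_ : ((2 : ℕ) : 𝓞 ℚ) ∈ v₂.asIdeal)
        (γᵥ : absoluteGaloisGroup (v₂.adicCompletion ℚ))
        (hsurj : Function.Surjective
          (κ.toContinuousMonoidHom.comp (resGalOfEmb (closureEmb (K := ℚ) (v₂.adicCompletion ℚ)))))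
        (hγᵥ : κ.IsTopGenerator (resGalOfEmb (closureEmb (K := ℚ) (v₂.adicCompletion ℚ)) γᵥ))
        (I : IwasawaH1Data W 2 κ γ) (J : LocalIwasawaH1Data κ v₂ ((tateRep W 2).toLocal v₂) γᵥ)
        (J' : LocalIwasawaH1Data κ v₂ (tateLocalOrdinaryRep W 2 v₂) γᵥ)
        (col : J.H →ₗ[IwasawaAlgebra 2] IwasawaAlgebra 2),
        (∀ x : J.H, col x = 0 ↔ x ∈ LinearMap.range (J'.ordinaryInclusion J)) →
        (∃ x : J.H, col x ∉ IwasawaAlgebra.augIdealP 2) →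
        ∃ g : I.H, IsEulerSystemClassTwo W hκ I g ∧ col (I.loc J hsurj hγ hγᵥ g) ∉ IwasawaAlgebra.augIdealP 2) :
    ZetaColemanMuIotaNegDiscAtTwo :=
  zetaColemanMuIotaNegDiscAtTwo_of_tateDuality_of_ordKernel_of_muFreeValue hPT
    (exists_ordinaryKernelFunctional_of_moduleFinite_of_ordinaryQuotientRank hfin hQ) hVflat

end Summit.BirchSwinnertonDyer.BirchSwinnertonDyer.Theorems.SteinbergFibreAtTwo

end
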